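import Summits.QuantumFields.YangMills.Theorems.BalabanUVNodesN22W1RelCentredSliceInputsLG
import Summits.QuantumFields.YangMills.Theorems.BalabanUVNodesN22W1RelCentredSliceInputsLGU
import Summits.QuantumFields.YangMills.Theorems.BalabanUVNodesN22W1RelCentredConfigAnalytic

/-!
# BalabanUVNodes ∕ node N22 = NE9 — THE RELATIVE-DISC CENTRED ROAD OVER THE ADMISSIBLE CLASS, MODULE J12-M: EVERY CONFIGURATION OF THE THICKENING GETS THE J10-D RECORD —
# `SliceInputsLGU → ∀ φ ∈ W, SliceInputsLG … φ …`, the two integral-level φ-analyticity fields `hMan` ∕ `hVan` SUPPLIED BY MODULE J11 from the primitive φ-laws, every other field by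
# specialisation at `φ`

Cell `pub-ymgap`, HUMAN RULING D-0062 (Track A), R134 ACCELERATION re-seat `pub-ymgap-dag-n22-c` (strategy s1), generation 9, file J12-M.  THEOREMS ONLY; imports J10-D `…SliceInputsLG`
(the per-configuration record the knit J10c consumes), J12-D `…SliceInputsLGU` (the uniform ∕ primitive record on an open thickening) and J11 `…ConfigAnalytic` (member and centre analytic
in the configuration from the primitive laws) BY NAME.  `--supports` K3⁷ `SpineGivenEndpointR13SepCoPH` (stmt-QuantumFields-20544) as a helper.

WHAT.  §0 faces of the uniform record (the per-bond multiplicity `hm₃` of the rate weight from the (2.19) profile and (1.26) on the torus — J10c §0's proof VERBATIM; the box-support law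
at a base point; the centre's `Σ|τ||𝒪(old, ξ; Y, 0)| ≤ ½a₀⟨B,B⟩ + w₀` at every `ξ ∈ W` from (L0) + the τ-radii + the closure `hw₀`).  §1 ★ `nonempty_sliceInputsLG_of_uniform`: for a record
`U : SliceInputsLGU … W …`, a base point `s₀ > 0`, `ρ_b < 1` and ANY `φ ∈ W`, the J10-D record `SliceInputsLG … φ …` is inhabited — the 174 shared fields by specialisation at `φ`, `hMan` by
J11 §1 `analyticOnNhd_memberOfDatum_config_of_localGrowth … φ hφ`, `hVan` by J11 §2 `analyticOnNhd_centreOfDatum_config_of_primitives … φ hφ` (field list GENERATED by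
`gen/build_j12m.py` from J12-D's).  Consequence (module J12-K): the knit J10c runs off ONE uniform record per slice and table, i.e. off located inputs NONE of which is an integral-level
analyticity statement.

HONEST FRAMING.  Count-neutral bookkeeping (record conversion; the only mathematics is J11's, cited); nothing of Bałaban's asserted; the uniform record's inhabitant at the datum of record
is NODE A's ∕ N09's ∕ N10's ∕ def-W1's business; N22 NOT discharged; one finite four-torus programme at fixed ε — NOT infinite volume, NOT OS on ℝ⁴, NOT a mass gap, NOT Clay.  0 `sorry`,
0 `def`, standard axioms.

References (TYPES only): [II] = [Balaban1988RG2Cluster] (1.5) p. 3, (1.26) p. 8, (1.41) p. 11, (2.14) p. 15 ll. 19–20, (2.18)–(2.20) p. 16; [I] = [Balaban1987RG1] §1 p. 263, (2.9) p. 266;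
[Chae1985] Thm 14.13.
-/

noncomputable section

namespace YMDAG.N22.W1

open Set Metric Matrix
open scoped BigOperators
open Literature.MathematicalPhysics.QuantumFieldTheory.Balaban1983to89
open Literature.MathematicalPhysics.QuantumFieldTheory.Balaban1983to89.TreeLengthTorus (TPt TDom tsys torusTreeLen ineq126_torus tcubeSys)
open Literature.MathematicalPhysics.QuantumFieldTheory.Balaban1983to89.B12TreeDecay (K₀ K₀_pos)
open Literature.MathematicalPhysics.QuantumFieldTheory.Balaban1983to89.Step (SFConsts)
open Literature.MathematicalPhysics.QuantumFieldTheory.Balaban1983to89.Node00.Sect2 (domSys domCount CPair Setting Residual)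
open Literature.MathematicalPhysics.QuantumFieldTheory.Balaban1983to89.Node00.W1

variable {N : ℕ}

namespace SliceInputsLGU

variable {c₀ : B13.Consts} {P : Params} {𝔸 : Type*} [NormedRing 𝔸] [NormedAlgebra ℂ 𝔸] [CompleteSpace 𝔸] {M k L : ℕ} [NeZero L]
  {𝔇 : TermDatum214 c₀ P 𝔸 M k L}
  {χu χcu : (Z : (domSys P M (k + 1)).Dom) → (t : TermLabel P M k L) → ((𝔇.𝒦 Z t).Λ → ℝ) → ℝ}
  {𝒲 : (Z : (domSys P M (k + 1)).Dom) → (t : TermLabel P M k L) → CPair P 𝔸 → TDom P.d (L * domCount P M (k + 1)) → ((𝔇.𝒦 Z t).Λ → ℝ) → ℂ}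
  {𝒪 : (Z : (domSys P M (k + 1)).Dom) → (t : TermLabel P M k L) → OlderTerms P 𝔸 M k → CPair P 𝔸 → TDom P.d (L * domCount P M (k + 1)) →
    ((𝔇.𝒦 Z t).Λ → ℝ) → ℂ}
  {c : B13.Consts} {G : Type*} [GaugeGroup G] {Sg : Setting 𝔸 G} {Rz : Residual P 𝔸} {cs : SFConsts} {E₀ κE : ℝ}
  {Z : (domSys P M (k + 1)).Dom} {t : TermLabel P M k L} {W : Set (CPair P 𝔸)} {s₀ a a₅ ρb Mv : ℝ}
  (U : SliceInputsLGU 𝔇 χu χcu 𝒲 𝒪 c Sg Rz cs E₀ κE Z t W s₀ a a₅ ρb Mv)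

/-! ## §0 Faces of the uniform record -/

/-- **The box-support law AT A REAL BASE POINT**: the s-free law read at `A := s·B`. [cite: Balaban1987RG1, (2.9) p.266; Balaban1988RG2Cluster, (2.3) p.12] -/
theorem hbox_smul (s : ℝ) : ∀ B : (𝔇.𝒦 Z t).Λ → ℝ, χu Z t (s • B) ≠ 0 → ∀ b ∈ U.S₀, |(s • B) b| ≤ U.ρ :=
  fun B hB => U.hbox (s • B) hB

/-- `0 ≤ m₃ = C_p·K₀(4·2^d, 2d)`. [cite: Balaban1988RG2Cluster, (2.20) p.16 (bookkeeping)] -/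
theorem hm₃0 : 0 ≤ U.Cp * B12TreeDecay.K₀ (4 * 2 ^ P.d) (2 * P.d) :=
  mul_nonneg U.hCp (K₀_pos _ _).le

/-- **THE PER-BOND MULTIPLICITY OF THE RATE WEIGHT, DERIVED** (J10c §0 `SliceInputsLG.hm₃`'s proof VERBATIM on the uniform record: cube-location (G), the (2.19) profile (P) and (1.26) ON
THE TORUS `TreeLengthTorus.ineq126_torus`): `Σ_{Y ∈ 𝐃, b ∈ S Y} R(Y)c₃(Y) ≤ C_p·K₀(4·2^d, 2d)`. [cite: Balaban1988RG2Cluster, (2.19)-(2.20) p.16 and (1.26) p.8] -/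
theorem hm₃ : ∀ bd : (𝔇.𝒦 Z t).Λ, ∑ Y ∈ t.1 with bd ∈ U.S Y, U.R Y * U.c₃ Y ≤ U.Cp * B12TreeDecay.K₀ (4 * 2 ^ P.d) (2 * P.d) := by
  intro bd
  have h126 := ineq126_torus P.d (L * domCount P M (k + 1)) U.hκp (U.cubeOf bd)
  calc ∑ Y ∈ t.1 with bd ∈ U.S Y, U.R Y * U.c₃ Y
      ≤ ∑ Y ∈ t.1 with bd ∈ U.S Y, U.Cp * Real.exp (-U.κp * (tsys P.d (L * domCount P M (k + 1))).dj Y) :=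
        Finset.sum_le_sum fun Y hY => U.hdecay Y (Finset.mem_filter.1 hY).1
    _ ≤ ∑ Y ∈ (tcubeSys P.d (L * domCount P M (k + 1))).above (U.cubeOf bd),
          U.Cp * Real.exp (-U.κp * (tsys P.d (L * domCount P M (k + 1))).dj Y) := by
        refine Finset.sum_le_sum_of_subset_of_nonneg (fun Y hY => ?_) fun Y _ _ => mul_nonneg U.hCp (Real.exp_nonneg _)
        have hY' := Finset.mem_filter.1 hY
        exact (B12TreeDecay.CubeSystem.mem_above (G := tcubeSys P.d (L * domCount P M (k + 1))) (c := U.cubeOf bd)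
          (X := Y)).2 (U.hS Y hY'.1 bd hY'.2)
    _ = U.Cp * ∑ Y ∈ (tcubeSys P.d (L * domCount P M (k + 1))).above (U.cubeOf bd),
          Real.exp (-U.κp * (tsys P.d (L * domCount P M (k + 1))).dj Y) := by rw [Finset.mul_sum]
    _ ≤ U.Cp * B12TreeDecay.K₀ (4 * 2 ^ P.d) (2 * P.d) := mul_le_mul_of_nonneg_left h126 U.hCp

/-- **THE CENTRE's QUADRATIC-FORM LETTER at every configuration of the thickening, DERIVED** from (L0), the τ-radii and the closure `hw₀` (J10c §0 `SliceInputsLG.h220V0` uniformly):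
`Σ|τ||𝒪(old, ξ; Y, 0)| ≤ ½a₀⟨B,B⟩ + w₀`, every admissible history. [cite: Balaban1988RG2Cluster, (2.18)-(2.20) p.16 and Lemma 2 p.11] -/
theorem h220V0 {old : OlderTerms P 𝔸 M k} (hA : old ∈ AdmHist (spaceOfRecord (M := M) Sg Rz (fun _ => cs.α₀) (fun _ => cs.α₁)) E₀ κE k) :
    ∀ ξ ∈ W, ∀ τ : TDom P.d (L * domCount P M (k + 1)) → ℂ, (∀ Y, τ Y ∈ U.Uτ Y) → ∀ B : (𝔇.𝒦 Z t).Λ → ℝ,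
      ∑ Y ∈ t.1, ‖τ Y‖ * ‖𝒪 Z t old ξ Y 0‖ ≤ U.a₀ / 2 * (B ⬝ᵥ B) + U.w₀ := fun ξ hξ τ hτ B =>
  ((Finset.sum_le_sum fun Y hY => mul_le_mul (U.hUτR Y hY (τ Y) (hτ Y)) (U.h0 old hA ξ hξ Y hY) (norm_nonneg _) (U.hR Y hY)).trans U.hw₀).trans
    (le_add_of_nonneg_left (mul_nonneg (div_nonneg U.ha₀ two_pos.le) (Finset.sum_nonneg fun i _ => mul_self_nonneg (B i))))

/-! ## §1 Every configuration of the thickening gets the J10-D record -/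

open Classical in
/-- **EVERY CONFIGURATION OF THE THICKENING GETS THE J10-D RECORD**: from a uniform ∕ primitive record `U : SliceInputsLGU … W …` at a base point `s₀ > 0` with `ρ_b < 1`, the record
`SliceInputsLG … φ …` of J10-D is inhabited at EVERY `φ ∈ W` — the shared fields by specialisation at `φ`, the member's φ-analyticity `hMan` by J11 §1 and the centre's `hVan` by J11 §2
from the primitive φ-laws `hAd`, `hGd`, `h𝒲d`, `h𝒪d` and the letters uniform on `W` ([II] p. 15 ll. 19–20 made a consequence).  Bookkeeping; the mathematics is J11's.
[cite: Balaban1988RG2Cluster, (2.14) p.15, (1.5) p.3, (1.41) p.11; Balaban1987RG1, §1 p.263; Chae1985, Thm 14.13] -/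
theorem nonempty_sliceInputsLG_of_uniform (U : SliceInputsLGU 𝔇 χu χcu 𝒲 𝒪 c Sg Rz cs E₀ κE Z t W s₀ a a₅ ρb Mv) (hs : 0 < s₀) (hρb1 : ρb < 1)
    {φ : CPair P 𝔸} (hφ : φ ∈ W) :
    Nonempty (SliceInputsLG 𝔇 χu χcu 𝒲 𝒪 c Sg Rz cs E₀ κE Z t φ s₀ a a₅ ρb Mv) :=
  ⟨{
    Uσ := U.Uσ
    Uτ := U.Uτ
    γ₂ := U.γ₂
    rP := U.rP
    qP := U.qP
    kap := U.kap
    kap' := U.kap'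
    kap'' := U.kap''
    θ := U.θ
    θE := U.θE
    θΓ := U.θΓ
    θC := U.θC
    KG := U.KG
    KΓ := U.KΓ
    KCs := U.KCs
    K₀ := U.K₀
    KE := U.KE
    KG' := U.KG'
    KCs' := U.KCs'
    θΓ' := U.θΓ'
    θC' := U.θC'
    θE' := U.θE'
    a' := U.a'
    w' := U.w'
    cE := U.cE
    g := U.g
    Rb := U.Rb
    κ := U.κ
    a₀ := U.a₀
    w₀ := U.w₀
    T := U.T
    α₀ := U.α₀
    r₁ := U.r₁
    TP := U.TP
    ac := U.ac
    wc := U.wc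
    hpos := U.hpos
    hhalf := U.hhalf
    hUσ := U.hUσ
    hUτ := U.hUτ
    hUexp := U.hUexp
    hUtau := U.hUtau
    hr := U.hr
    hr' := U.hr'
    hsubτ := U.hsubτ
    hχ0 := U.hχ0
    hχc0 := U.hχc0
    hχm := U.hχm
    hχcm := U.hχcm
    h222 := U.h222
    hγ₂ := U.hγ₂
    hqP := U.hqP
    hAhol := U.hAhol φ hφ
    hGhol := U.hGhol φ hφ
    hAs := U.hAs φ hφ
    hfibN := U.hfibN
    hkap'' := U.hkap''
    hk1 := U.hk1
    hk2 := U.hk2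
    hθE := U.hθE
    hθΓ := U.hθΓ
    hθC := U.hθC
    hKG := U.hKG
    hKΓ := U.hKΓ
    hKCs := U.hKCs
    hK₀ := U.hK₀
    hKE := U.hKE
    hG := U.hG φ hφ
    hΓ₀ := U.hΓ₀
    hCs := U.hCs φ hφ
    hC216 := U.hC216
    hCE := U.hCE
    hdΓ := U.hdΓ φ hφ
    hdC := U.hdC φ hφ
    hdE := U.hdE φ hφ
    hKG' := U.hKG'
    hKCs' := U.hKCs'
    hθΓ' := U.hθΓ'
    hθC' := U.hθC'
    hθE' := U.hθE'
    hθEle := U.hθEle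
    hθΓle := U.hθΓle
    hθR1le := U.hθR1le
    hsmallKθ := U.hsmallKθ
    hc0 := U.hc0
    hc := U.hc
    hαc := U.hαc
    hg := U.hg
    hΓq := U.hΓq
    hsmall := U.hsmall
    hPa := U.hPa
    hvol := U.hvol
    hχe := U.hχe
    hχce := U.hχce
    hαc_c := U.hαc_c
    hsmall_c := U.hsmall_c
    hvol_c := U.hvol_c
    hχ1 := U.hχ1
    hκ := U.hκ
    hboxR := U.hboxR
    ha₀ := U.ha₀
    hαc_b := U.hαc_b
    hsmall_b := U.hsmall_b
    hvol_b := U.hvol_b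
    hα₀ := U.hα₀
    hαc_f := U.hαc_f
    hsmall_f := U.hsmall_f
    hr₁ := U.hr₁
    hPa1 := U.hPa1
    hA := U.hA φ hφ
    hθEle0 := U.hθEle0
    hθΓle0 := U.hθΓle0
    hθR1le0 := U.hθR1le0
    hαc_0 := U.hαc_0
    hsmall_0 := U.hsmall_0
    hvol_0 := U.hvol_0
    hRb := U.hRb
    hTP := U.hTP
    hMvT := U.hMvT
    hMvP := U.hMvP
    𝒲₃ := U.𝒲₃
    D𝒪 := U.D𝒪
    ρ := U.ρ
    hρ := U.hρ
    h𝒲m := U.h𝒲m φ hφ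
    h𝒲₃m := U.h𝒲₃m
    h𝒲₃ := U.h𝒲₃
    R := U.R
    c₀ := U.c₀
    c₃ := U.c₃
    c₃' := U.c₃'
    c₄ := U.c₄
    c₁ := U.c₁
    c₁' := U.c₁'
    c₂ := U.c₂
    hR := U.hR
    hc₃ := U.hc₃
    hc₃' := U.hc₃'
    hc₄ := U.hc₄
    hc₁ := U.hc₁
    hc₁' := U.hc₁'
    hc₂ := U.hc₂
    hUτR := U.hUτR
    h1 := U.h1 φ hφ
    S := U.S
    h1loc := U.h1loc φ hφ
    cubeOf := U.cubeOf
    hS := U.hS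
    Cp := U.Cp
    κp := U.κp
    hCp := U.hCp
    hκp := U.hκp
    hdecay := U.hdecay
    h2 := U.h2 φ hφ
    h3 := U.h3
    S₀ := U.S₀
    hbox := U.hbox
    hloc𝒲 := U.hloc𝒲 φ hφ
    δ := U.δ
    hδ := U.hδ
    h𝒪m := fun old hA => U.h𝒪m old hA φ hφ
    hD𝒪m := U.hD𝒪m
    hD𝒪 := U.hD𝒪
    h0 := fun old hA => U.h0 old hA φ hφ
    h4 := fun old hA => U.h4 old hA φ hφ
    h5 := fun old hA => U.h5 old hA φ hφ
    h6 := U.h6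
    hloc𝒪 := fun old hA => U.hloc𝒪 old hA φ hφ
    hOhol := U.hOhol φ hφ
    ha' := U.ha'
    hw' := U.hw'
    hac := U.hac
    hwc := U.hwc
    hw₀ := U.hw₀
    hMan := fun old hA b hb =>
      analyticOnNhd_memberOfDatum_config_of_localGrowth 𝔇 χu χcu 𝒲 𝒪 Z t old s₀ U.hW c U.hUσ U.hUτ U.hUexp U.hr U.hr' U.hsubτ U.hχ0 U.hχc0 hs U.hρ.le
        U.hAhol U.hAd U.hχm U.hχcm U.h𝒲m U.h𝒲d (U.h𝒪m old hA) (U.h𝒪d old hA) U.hAs U.hGhol U.hGd U.qP U.h222 U.hγ₂ U.hqP U.hR U.hc₃ U.hc₁ U.hUτR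
        (U.h0 old hA) U.S U.h1loc (U.h4 old hA) U.hm₃0 U.hm₃ U.S₀ (U.hbox_smul s₀) U.hloc𝒲 (U.hloc𝒪 old hA) U.hfibN U.hkap'' U.hk1 U.hk2 U.hθE U.hθΓ
        U.hθC U.hKG U.hKΓ U.hKCs U.hK₀ U.hKE U.hG U.hΓ₀ U.hCs U.hC216 U.hCE U.hdΓ U.hdC U.hdE hρb1 U.hKG' U.hKCs' U.hθΓ' U.hθC' U.hθE' U.ha' U.hw'
        U.hθEle U.hθΓle U.hθR1le U.hsmallKθ U.hc0 U.hc U.hαc U.hΓq U.hsmall hb φ hφ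
    hVan := fun old hA hP =>
      analyticOnNhd_centreOfDatum_config_of_primitives 𝔇 𝒪 Z t old (by rw [hP, Finset.card_empty]) U.hW c U.hUσ U.hUτ U.hUexp U.hr U.hr' U.hsubτ
        U.hAhol U.hAd U.hAs U.hA U.hGhol U.hGd (fun Y => U.h𝒪d old hA Y 0) U.hγ₂ U.ha₀ U.hfibN U.hkap'' U.hk1 U.hk2 U.hθE U.hθΓ U.hθC U.hKG U.hKΓ
        U.hKCs U.hK₀ U.hθEle0 U.hθΓle0 U.hθR1le0 U.hG U.hΓ₀ U.hCs U.hC216 U.hdΓ U.hdC U.hdE U.hsmallKθ U.hc0 U.hc U.hαc_0 U.hΓq U.hsmall_0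
        (U.h220V0 hA) φ hφ }⟩

end SliceInputsLGU

end YMDAG.N22.W1

end
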